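import Mathlib.Analysis.Convex.Hull
import Mathlib.Analysis.Convex.Segment
import Mathlib.LinearAlgebra.Matrix.Rank
import Mathlib.LinearAlgebra.FiniteDimensional.Lemmas
import Mathlib.Data.Matrix.Mul
import HarnessLib

/-!
# Certificates for `{x : A x + z ≥ 0} ⊆ conv(V)` — the mathematical steps

Topic `Computability/AlgebraicComplexity` (support for the verified V-description of the Kronecker
polytope `Kron(4,4,4)`, `Kron444Hull*.lean`, serving the named fact
`vandenBergEtAl2025_unitTensor_four_polytope_maximal`). Deciding that an `H`-polytope is contained
in the convex hull of a finite point set is the polytope verification / vertex enumeration problem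
[Ziegler1995, Lecture 1; Schrijver1986, §8]; we certify it by the classical recursion over faces
("every point of a polytope lies on a segment from a vertex to a point of a proper face", i.e. a
pulling decomposition [Ziegler1995, §8.1]) with LP-duality (Farkas) multipliers for the linear
facts used along the way [Schrijver1986, Cor. 7.1e, §7.8]. This file proves the data-independent
lemmas of that scheme, over `ℚ`:

* `exists_exit_point` — **line shooting**: if `v` and `x` satisfy finitely many affine
  inequalities and some linear part is negative along `x - v`, then the ray from `v` through `x`
  leaves the polyhedron at a point `y = v + t (x - v)`, `t ≥ 1`, where one of these inequalities is
  tight; and `mem_convexHull_of_exit` — then `x ∈ [v, y] ⊆ conv S` once `v ∈ S`, `y ∈ conv S`;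
* `eq_zero_of_nonneg_of_combination` — **boundedness from a positive combination**: if
  `∑ yₖ aₖ + ∑ z_b a_b = 0` with all `yₖ ≥ 1`, then a direction `u` with `aₖ·u ≥ 0`, `a_b·u = 0` has
  `aₖ·u = 0` for all `k`;
* `linearIndependent_rows_of_mul_eq_smul_one`, `eq_zero_of_forall_row_dot_eq_zero` — **rank
  certificates**: an integer matrix some square column-minor (row-minor) of which has an integer
  inverse up to a non-zero scalar has independent rows (only the zero vector is orthogonal to all
  its rows);
* `eval_eq_zero_of_vanish_on_points` — **transfer of tight equalities along an edge of the face
  lattice**: if linearly independent affine functionals `g₁, …, g_t` and a functional `f` all vanish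
  on `s` affinely independent points with `t + s ≥ n + 1`, then `f` is a linear combination of the
  `gᵢ`; in particular `f` vanishes wherever all `gᵢ` do (dimension count in the dual space
  `ℚⁿ⁺¹` of affine functionals: `span(g) = annihilator(points)`).

All statements are elementary linear algebra / convexity [folklore]; they are combined with a
finite certificate by the checker of `Kron444HullCheck.lean`.

## References

* [Ziegler1995] G. M. Ziegler, *Lectures on Polytopes*, GTM 152, Springer 1995, Lecture 1
  (V- and H-polytopes, Thm. 1.1), §2.1 (faces), §8.1 (pulling triangulations).
* [Schrijver1986] A. Schrijver, *Theory of Linear and Integer Programming*, Wiley 1986, §7.3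
  (Farkas' lemma, Cor. 7.1e), §7.8, §8.
-/

open scoped BigOperators Matrix

namespace Literature.Computability.AlgebraicComplexity

namespace HullCert

/-! ## §1 Line shooting -/

section Shooting

variable {n : ℕ} {ι : Type*}

/-- **Line shooting.** Let finitely many affine functionals `x ↦ a i ⬝ x + b i` (`i ∈ s`) be
non-negative at `v` and at `x`, and suppose some linear part is negative in the direction
`u = x - v`. Then for the smallest ratio `t = min (a i ⬝ v + b i) / (-(a i ⬝ u))` over those `i`
one has `t ≥ 1`, the point `y = v + t u` still satisfies all the inequalities, and one of them
(with `a i₀ ⬝ u < 0`) is tight at `y`. [cite: Ziegler1995, Lecture 1 (proof of Thm. 1.1) and §8.1]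
-/
theorem exists_exit_point (s : Finset ι) (a : ι → Fin n → ℚ) (b : ι → ℚ) (v x : Fin n → ℚ)
    (hv : ∀ i ∈ s, 0 ≤ a i ⬝ᵥ v + b i) (hx : ∀ i ∈ s, 0 ≤ a i ⬝ᵥ x + b i)
    (hex : ∃ i ∈ s, a i ⬝ᵥ (x - v) < 0) :
    ∃ (t : ℚ) (i₀ : ι), i₀ ∈ s ∧ 1 ≤ t ∧ (∀ i ∈ s, 0 ≤ a i ⬝ᵥ (v + t • (x - v)) + b i) ∧
      a i₀ ⬝ᵥ (v + t • (x - v)) + b i₀ = 0 ∧ a i₀ ⬝ᵥ (x - v) < 0 := by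
  classical
  set u := x - v with hu
  set K := s.filter (fun i => a i ⬝ᵥ u < 0) with hK
  have hKne : K.Nonempty := by
    obtain ⟨i, hi, hneg⟩ := hex
    exact ⟨i, Finset.mem_filter.2 ⟨hi, hneg⟩⟩
  set ρ : ι → ℚ := fun i => (a i ⬝ᵥ v + b i) / (-(a i ⬝ᵥ u)) with hρ
  obtain ⟨i₀, hi₀K, hmin⟩ := K.exists_min_image ρ hKne
  obtain ⟨hi₀s, hi₀neg⟩ := Finset.mem_filter.1 hi₀K
  set t := ρ i₀ with ht
  -- the value of functional `i` at `v + t u`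
  have hval : ∀ i, a i ⬝ᵥ (v + t • u) + b i = (a i ⬝ᵥ v + b i) + t * (a i ⬝ᵥ u) := by
    intro i
    rw [dotProduct_add, dotProduct_smul, smul_eq_mul]
    ring
  -- ratios are at least one
  have hρ1 : ∀ i ∈ K, 1 ≤ ρ i := by
    intro i hi
    obtain ⟨his, hineg⟩ := Finset.mem_filter.1 hi
    have hxi := hx i his
    have e : a i ⬝ᵥ x = a i ⬝ᵥ v + a i ⬝ᵥ u := by rw [hu, dotProduct_sub]; ring
    rw [hρ]
    rw [le_div_iff₀ (by linarith), one_mul]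
    linarith
  refine ⟨t, i₀, hi₀s, hρ1 i₀ hi₀K, ?_, ?_, hi₀neg⟩
  · intro i hi
    rw [hval]
    by_cases hneg : a i ⬝ᵥ u < 0
    · -- `t ≤ ρ i`
      have hle : t ≤ ρ i := hmin i (Finset.mem_filter.2 ⟨hi, hneg⟩)
      rw [hρ] at hle
      rw [le_div_iff₀ (by linarith)] at hle
      linarith
    · push Not at hneg
      have h1 : 0 ≤ t := le_trans zero_le_one (hρ1 i₀ hi₀K)
      have := hv i hi
      positivity
  · rw [hval]
    have e : t * (a i₀ ⬝ᵥ u) = -(a i₀ ⬝ᵥ v + b i₀) := by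
      have hne : a i₀ ⬝ᵥ u ≠ 0 := ne_of_lt hi₀neg
      rw [ht, hρ]
      field_simp
    linarith

/-- **From the exit point to the convex hull.** If `y = v + t (x - v)` with `t ≥ 1`, `v ∈ S` and
`y ∈ conv S`, then `x ∈ conv S` (`x` lies on the segment `[v, y]`). [folklore] -/
theorem mem_convexHull_of_exit {S : Set (Fin n → ℚ)} {v x : Fin n → ℚ} {t : ℚ} (ht : 1 ≤ t)
    (hv : v ∈ S) (hy : v + t • (x - v) ∈ convexHull ℚ S) : x ∈ convexHull ℚ S := by
  have hseg : x ∈ segment ℚ v (v + t • (x - v)) := by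
    rw [segment_eq_image]
    refine ⟨t⁻¹, ⟨inv_nonneg.2 (le_trans zero_le_one ht), inv_le_one_of_one_le₀ ht⟩, ?_⟩
    have ht0 : t ≠ 0 := by linarith
    funext i
    simp only [Pi.add_apply, Pi.smul_apply, Pi.sub_apply, smul_eq_mul]
    field_simp
    ring
  exact (convex_convexHull ℚ S).segment_subset (subset_convexHull ℚ S hv) hy hseg

end Shooting

/-! ## §2 Boundedness from a positive combination of the inequality normals -/

section Bounded

variable {n : ℕ}

/-- If `∑ₖ yₖ (aₖ ⬝ u) + c = 0` where every `yₖ ≥ 1`, every `aₖ ⬝ u ≥ 0` and `c = 0`, then every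
`aₖ ⬝ u = 0` (a sum of non-negative terms vanishes termwise). Used with the identity
`∑ yₖ aₖ + ∑ z_b a_b + ∑ z'_t 1_t = 0` of a boundedness certificate, paired with a direction `u`
along which the equality functionals vanish. [cite: Schrijver1986, §7.8 (characterisation of
bounded polyhedra)] -/
theorem forall_eq_zero_of_sum_mul_eq_zero {ι : Type*} (s : Finset ι) (y : ι → ℚ) (d : ι → ℚ)
    (hy : ∀ i ∈ s, 1 ≤ y i) (hd : ∀ i ∈ s, 0 ≤ d i) (h : ∑ i ∈ s, y i * d i = 0) :
    ∀ i ∈ s, d i = 0 := by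
  have hterm : ∀ i ∈ s, 0 ≤ y i * d i := fun i hi =>
    mul_nonneg (le_trans zero_le_one (hy i hi)) (hd i hi)
  have hz := (Finset.sum_eq_zero_iff_of_nonneg hterm).1 h
  intro i hi
  have := hz i hi
  rcases mul_eq_zero.1 this with h1 | h1
  · exact absurd h1 (by linarith [hy i hi])
  · exact h1

end Bounded

/-! ## §3 Rank certificates: a square minor with an inverse up to a non-zero scalar -/

section Rank

variable {R : Type*} [Field R] {m k : ℕ}

/-- **Independent rows from an invertible column-minor.** If `M` is a `m × k` matrix and for some
choice of `m` columns `J` the square minor `M_J` satisfies `M_J * N = D • 1` with `D ≠ 0`, then the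
rows of `M` are linearly independent. [folklore] -/
theorem linearIndependent_rows_of_mul_eq_smul_one (M : Matrix (Fin m) (Fin k) R) (J : Fin m → Fin k)
    (N : Matrix (Fin m) (Fin m) R) {D : R} (hD : D ≠ 0)
    (h : (M.submatrix id J) * N = D • (1 : Matrix (Fin m) (Fin m) R)) :
    LinearIndependent R (fun i => M i) := by
  rw [Fintype.linearIndependent_iff]
  intro c hc i
  -- `c ᵥ* M = 0`, hence `c ᵥ* M_J = 0`, hence `D • c = 0`
  have hcM : c ᵥ* (M.submatrix id J) = 0 := by
    funext j
    have := congrFun hc (J j)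
    simp only [Finset.sum_apply, Pi.smul_apply, smul_eq_mul, Pi.zero_apply] at this
    simp only [Matrix.vecMul, dotProduct, Matrix.submatrix_apply, id_eq, Pi.zero_apply]
    rw [← this]
  have h2 := congrArg (fun w => w ᵥ* N) hcM
  simp only [Matrix.vecMul_vecMul, h, Matrix.zero_vecMul, Matrix.vecMul_smul, Matrix.vecMul_one] at h2
  have h3 := congrFun h2 i
  simp only [Pi.smul_apply, smul_eq_mul, Pi.zero_apply] at h3
  exact (mul_eq_zero.1 h3).resolve_left hD

/-- **Only zero is orthogonal to all rows, from an invertible row-minor.** If `M` is a `m × k`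
matrix and for some choice of `k` rows `I` the square minor `M^I` satisfies `N * M^I = D • 1` with
`D ≠ 0`, then `M u = 0` forces `u = 0`. [folklore] -/
theorem eq_zero_of_mulVec_eq_zero (M : Matrix (Fin m) (Fin k) R) (I : Fin k → Fin m)
    (N : Matrix (Fin k) (Fin k) R) {D : R} (hD : D ≠ 0)
    (h : N * (M.submatrix I id) = D • (1 : Matrix (Fin k) (Fin k) R)) {u : Fin k → R}
    (hu : M *ᵥ u = 0) : u = 0 := by
  have hI : (M.submatrix I id) *ᵥ u = 0 := by
    funext i
    have := congrFun hu (I i)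
    simpa [Matrix.mulVec, Matrix.submatrix_apply] using this
  have h2 := congrArg (fun w => N *ᵥ w) hI
  simp only [Matrix.mulVec_mulVec, h, Matrix.mulVec_zero, Matrix.smul_mulVec, Matrix.one_mulVec] at h2
  funext i
  have h3 := congrFun h2 i
  simp only [Pi.smul_apply, smul_eq_mul, Pi.zero_apply] at h3
  exact (mul_eq_zero.1 h3).resolve_left hD

end Rank

/-! ## §4 Transfer of tight equalities: independent functionals vanishing on independent points -/

section Transfer

variable {N : ℕ}

/-- **Dimension count in the dual.** Let `g : Fin t → (Fin N → ℚ)` be linearly independent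
vectors ("functionals") and `p : Fin s → (Fin N → ℚ)` linearly independent vectors ("points")
with `g i ⬝ p j = 0` for all `i, j`, and `t + s ≥ N`. Then every vector `f` orthogonal to all the
`p j` lies in the span of the `g i`: the annihilator of the points has dimension `N - s ≤ t`.
[folklore] -/
theorem mem_span_of_forall_dot_eq_zero {t s : ℕ} (g : Fin t → Fin N → ℚ) (p : Fin s → Fin N → ℚ)
    (hg : LinearIndependent ℚ g) (hp : LinearIndependent ℚ p)
    (hgp : ∀ i j, g i ⬝ᵥ p j = 0) (hts : N ≤ t + s) {f : Fin N → ℚ} (hf : ∀ j, f ⬝ᵥ p j = 0) :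
    f ∈ Submodule.span ℚ (Set.range g) := by
  classical
  -- the evaluation map on the points, as the matrix with rows `p j`
  let P : Matrix (Fin s) (Fin N) ℚ := Matrix.of p
  let ev : (Fin N → ℚ) →ₗ[ℚ] (Fin s → ℚ) := P.mulVecLin
  have hev : ∀ w, ev w = fun j => p j ⬝ᵥ w := fun w => rfl
  -- its rank is `s` (independent rows), so its kernel has dimension `N - s`
  have hrank : Module.finrank ℚ (LinearMap.range ev) = s := by
    change P.rank = s
    rw [Matrix.rank_eq_finrank_span_row, finrank_span_eq_card]
    · exact (Fintype.card_fin s)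
    · exact hp
  have hker : Module.finrank ℚ (LinearMap.ker ev) + s = N := by
    have := LinearMap.finrank_range_add_finrank_ker ev
    rw [hrank, Module.finrank_fin_fun] at this
    omega
  -- `span g ≤ ker ev`, with `finrank (span g) = t ≥ N - s = finrank ker`
  have hle : Submodule.span ℚ (Set.range g) ≤ LinearMap.ker ev := by
    rw [Submodule.span_le]
    rintro _ ⟨i, rfl⟩
    rw [SetLike.mem_coe, LinearMap.mem_ker, hev]
    funext j
    rw [Pi.zero_apply, dotProduct_comm]
    exact hgp i j
  have hspan : Module.finrank ℚ (Submodule.span ℚ (Set.range g)) = t := by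
    rw [finrank_span_eq_card hg, Fintype.card_fin]
  have heq : Submodule.span ℚ (Set.range g) = LinearMap.ker ev :=
    Submodule.eq_of_le_of_finrank_le hle (by rw [hspan]; omega)
  rw [heq, LinearMap.mem_ker, hev]
  funext j
  rw [Pi.zero_apply, dotProduct_comm]
  exact hf j

/-- **Transfer of tight equalities.** In the situation of `mem_span_of_forall_dot_eq_zero`, if
moreover all `g i` are orthogonal to a vector `q` ("the functionals `gᵢ` vanish at the point `q`")
then so is `f`. [folklore] -/
theorem dot_eq_zero_of_forall_dot_eq_zero {t s : ℕ} (g : Fin t → Fin N → ℚ) (p : Fin s → Fin N → ℚ)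
    (hg : LinearIndependent ℚ g) (hp : LinearIndependent ℚ p)
    (hgp : ∀ i j, g i ⬝ᵥ p j = 0) (hts : N ≤ t + s) {f : Fin N → ℚ} (hf : ∀ j, f ⬝ᵥ p j = 0)
    {q : Fin N → ℚ} (hq : ∀ i, g i ⬝ᵥ q = 0) : f ⬝ᵥ q = 0 := by
  have hmem := mem_span_of_forall_dot_eq_zero g p hg hp hgp hts hf
  refine Submodule.span_induction (p := fun w _ => w ⬝ᵥ q = 0) ?_ ?_ ?_ ?_ hmem
  · rintro _ ⟨i, rfl⟩; exact hq i
  · exact zero_dotProduct q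
  · intro a b _ _ ha hb; rw [add_dotProduct, ha, hb, add_zero]
  · intro c a _ ha; rw [smul_dotProduct, ha, smul_zero]

end Transfer

end HullCert

end Literature.Computability.AlgebraicComplexity
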